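import Mathlib
import Literature.Computability.AlgebraicComplexity.GroupTheoreticMatMul
import Literature.Computability.AlgebraicComplexity.STPPLineFamilies
import Summits.MatrixMultiplication.MatrixMultiplication.Theorems.AbelianSTPPCensusTargets
import Summits.MatrixMultiplication.MatrixMultiplication.Theorems.AbelianSTPPSieve
import Summits.MatrixMultiplication.MatrixMultiplication.Theorems.AbelianSTPPCensusSieveRulesPacking

/-!
# Abelian STPP census: the glue from the census cruxes to the rung leaf `NoAbelianSTPPHost_250_127`

Support file for route `MatrixMultiplication/GroupTheoreticSTPP`, negative crux
`stmt-MatrixMultiplication-0596` (`CAbelianObstructionNeg`), finite-range evidence; cell mm-stpp, rung F-M1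
(D-0059/D-0061), draft route `AbelianSTPPCensus` (HOME/mm-stpp-plan/route/: `closes : SieveSound →
ShapeExclusionTE → TEOrder125 → TEResidualSmall → TEResidualLarge → CensusGlueTE127 → NoAbelianSTPPHost_250_127`).

* `noAbelianSTPPHostUpTo_of_two` (analytic glue, any `0 < τ ≤ 3`, any range `M₀`): it suffices to bound
  `Σ V_i^{τ/3}` for STPP families with at least two members and all sets non-empty — degenerate members
  contribute `0`, and one non-degenerate member has `V^{τ/3} ≤ V ≤ |H|` by volume injectivity (U1,
  `STPPSieveRules.card_image_sgnSum`).
* `noAbelianSTPPHost_250_127_of_cruxes` = the body of the support item `CensusGlueTE127` with the five item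
  statements of the draft route as hypotheses (verbatim): sieve soundness, the arithmetic shape exclusion
  for `T_E` up to order 127, and the three residual cruxes imply the leaf.  Four of the five hypotheses are
  theorems of this directory (`AbelianTECensus.sieveSound`, `teOrder125`, `teResidualSmall`,
  `teResidualLarge`); the remaining one, `ShapeExclusionTE`, is the certificate replay of the sieve run.

WHAT THIS IS NOT: no `ω` statement; bookkeeping between finite-range census statements.
-/

-- single-conjunct summit: the mandated namespace repeats `MatrixMultiplication`.
set_option linter.dupNamespace false

namespace Summit.MatrixMultiplication.MatrixMultiplication.Theorems

/-! ### Glue: from the census cruxes to the rung leaf -/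

namespace AbelianTECensus

open Finset Literature.Computability.AlgebraicComplexity

/-- **Analytic glue.** If for some `0 < τ ≤ 3` no STPP family with at least two members, all sets
non-empty, in an abelian group of order `≤ M₀` beats exponent `τ`, then `NoAbelianSTPPHostUpTo τ M₀`:
members with an empty set contribute `0` to `Σ V_i^{τ/3}`, and a single non-degenerate member has
`V^{τ/3} ≤ V ≤ |H|` (volume injectivity, U1). [original] -/
theorem noAbelianSTPPHostUpTo_of_two {τ : ℝ} (hτ0 : 0 < τ) (hτ3 : τ ≤ 3) {M₀ : ℕ}
    (hex : ∀ (H : Type) [AddCommGroup H] [Fintype H], Fintype.card H ≤ M₀ →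
      ∀ (N : ℕ) (A B C : Fin N → Finset H), IsSTPP A B C →
        (∀ i, (A i).Nonempty ∧ (B i).Nonempty ∧ (C i).Nonempty) → 2 ≤ N →
          ∑ i, (((A i).card * (B i).card * (C i).card : ℕ) : ℝ) ^ (τ / 3) ≤ (Fintype.card H : ℝ)) :
    NoAbelianSTPPHostUpTo τ M₀ := by
  intro H _ _ hM N A B C h
  classical
  set f : Fin N → ℝ := fun i => (((A i).card * (B i).card * (C i).card : ℕ) : ℝ) ^ (τ / 3) with hf
  set I : Finset (Fin N) := univ.filter fun i => (A i).Nonempty ∧ (B i).Nonempty ∧ (C i).Nonempty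
    with hI
  have hzero : ∀ i ∈ (univ : Finset (Fin N)), i ∉ I → f i = 0 := by
    intro i _ hi
    have h0 : (A i).card * (B i).card * (C i).card = 0 := by
      simp only [hI, mem_filter, mem_univ, true_and, not_and_or, not_nonempty_iff_eq_empty] at hi
      rcases hi with h0 | h0 | h0 <;> simp [h0]
    simp only [hf, h0, Nat.cast_zero]
    exact Real.zero_rpow (by positivity)
  have hsum : ∑ i, f i = ∑ i ∈ I, f i := (sum_subset (subset_univ I) hzero).symm
  show ∑ i, f i ≤ _
  rw [hsum]
  rcases Nat.lt_or_ge I.card 2 with hlt | hge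
  · -- at most one non-degenerate member
    rcases I.eq_empty_or_nonempty with hI0 | ⟨i₀, hi₀⟩
    · rw [hI0, sum_empty]; positivity
    · have hI1 : I = {i₀} := by
        rw [eq_singleton_iff_unique_mem]
        refine ⟨hi₀, fun x hx => ?_⟩
        exact card_le_one.1 (by omega) x hx i₀ hi₀
      rw [hI1, sum_singleton, hf]
      have hV : (A i₀).card * (B i₀).card * (C i₀).card ≤ Fintype.card H := by
        have := card_le_univ (((A i₀) ×ˢ (B i₀) ×ˢ (C i₀)).image (STPPSieveRules.sgnSum (H := H)))
        rwa [STPPSieveRules.card_image_sgnSum h i₀] at this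
      have hne : (A i₀).Nonempty ∧ (B i₀).Nonempty ∧ (C i₀).Nonempty := by
        have := hi₀; rw [hI, mem_filter] at this; exact this.2
      have hV1 : 1 ≤ (A i₀).card * (B i₀).card * (C i₀).card :=
        Nat.mul_pos (Nat.mul_pos hne.1.card_pos hne.2.1.card_pos) hne.2.2.card_pos
      have hV1' : (1 : ℝ) ≤ (((A i₀).card * (B i₀).card * (C i₀).card : ℕ) : ℝ) := by
        exact_mod_cast hV1
      calc (((A i₀).card * (B i₀).card * (C i₀).card : ℕ) : ℝ) ^ (τ / 3)
          ≤ (((A i₀).card * (B i₀).card * (C i₀).card : ℕ) : ℝ) :=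
            Real.rpow_le_self_of_one_le hV1' (by linarith)
        _ ≤ (Fintype.card H : ℝ) := by exact_mod_cast hV
  · -- reindex the non-degenerate members by `Fin I.card`
    set e : Fin I.card ≃ I := I.equivFin.symm with he
    set φ : Fin I.card → Fin N := fun r => (e r).1 with hφ
    have hφinj : Function.Injective φ := fun r s hrs => e.injective (Subtype.ext hrs)
    have hφI : ∀ r, φ r ∈ I := fun r => (e r).2
    have h' : IsSTPP (fun r => A (φ r)) (fun r => B (φ r)) (fun r => C (φ r)) :=
      h.comp_of_injective φ hφinj
    have hne' : ∀ r, (A (φ r)).Nonempty ∧ (B (φ r)).Nonempty ∧ (C (φ r)).Nonempty := fun r => by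
      have := hφI r; rw [hI, mem_filter] at this; exact this.2
    have hsum' : ∑ i ∈ I, f i = ∑ r : Fin I.card, f (φ r) := by
      rw [← sum_coe_sort I]
      exact (Equiv.sum_comp e (fun x : I => f x.1)).symm
    rw [hsum']
    exact hex H hM I.card _ _ _ h' hne' hge

/-- **Census glue for `T_E / 127`** (body of the support item `CensusGlueTE127` of the draft route
`AbelianSTPPCensus`, HOME/mm-stpp-plan/route/Sketch.lean, with the five item statements as hypotheses):
sieve soundness + the arithmetic shape exclusion + the three residual cruxes give the rung leaf
`NoAbelianSTPPHost_250_127`. [original] -/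
theorem noAbelianSTPPHost_250_127_of_cruxes
    (h₀ : ∀ (H : Type) [AddCommGroup H] [Fintype H] (N : ℕ) (A B C : Fin N → Finset H), IsSTPP A B C →
      (∀ i, (A i).Nonempty ∧ (B i).Nonempty ∧ (C i).Nonempty) →
        SieveAdmissible (Fintype.card H) (fun i => (A i).card) (fun i => (B i).card)
          (fun i => (C i).card))
    (h₁ : ∀ (N M : ℕ) (a b c : Fin N → ℕ), 2 ≤ N → M ≤ 127 → SieveAdmissible M a b c →
      Beats (5 / 2) M a b c →
      (M = 111 ∧ HasSubShapes a b c [(4,4,4),(4,4,4),(4,4,4),(3,3,3)]) ∨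
      ((M = 120 ∨ M = 121) ∧ (HasSubShapes a b c [(4,4,4),(4,4,4),(4,4,4),(4,4,3)] ∨
          HasSubShapes a b c [(4,4,4),(4,4,4),(4,4,4),(4,3,4)] ∨
          HasSubShapes a b c [(4,4,4),(4,4,4),(4,4,4),(3,4,4)])) ∨
      (M = 124 ∧ (HasSubShapes a b c [(5,4,3),(3,4,5),(4,4,4),(4,4,4)] ∨
          HasSubShapes a b c [(5,3,4),(3,5,4),(4,4,4),(4,4,4)] ∨
          HasSubShapes a b c [(4,5,3),(4,3,5),(4,4,4),(4,4,4)] ∨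
          HasSubShapes a b c [(4,4,4),(4,4,4),(4,4,4),(4,4,4)])) ∨
      (M = 125 ∧ (HasSubShapes a b c [(4,4,4),(4,4,4),(4,4,4),(4,4,4)] ∨
          HasSubShapes a b c [(5,5,3),(5,3,5),(3,5,5),(3,3,3)])) ∨
      ((M = 126 ∨ M = 127) ∧ HasSubShapes a b c [(4,4,4),(4,4,4),(4,4,4),(4,4,4)]))
    (h₂ : NoSTPPSubfamily 125 [(4,4,4),(4,4,4),(4,4,4),(4,4,4)] ∧
      NoSTPPSubfamily 125 [(5,5,3),(5,3,5),(3,5,5),(3,3,3)])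
    (h₃ : NoSTPPSubfamily 111 [(4,4,4),(4,4,4),(4,4,4),(3,3,3)] ∧
      (∀ M, M = 120 ∨ M = 121 → NoSTPPSubfamily M [(4,4,4),(4,4,4),(4,4,4),(4,4,3)] ∧
        NoSTPPSubfamily M [(4,4,4),(4,4,4),(4,4,4),(4,3,4)] ∧
          NoSTPPSubfamily M [(4,4,4),(4,4,4),(4,4,4),(3,4,4)]))
    (h₄ : (NoSTPPSubfamily 124 [(5,4,3),(3,4,5),(4,4,4),(4,4,4)] ∧
        NoSTPPSubfamily 124 [(5,3,4),(3,5,4),(4,4,4),(4,4,4)] ∧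
          NoSTPPSubfamily 124 [(4,5,3),(4,3,5),(4,4,4),(4,4,4)] ∧
            NoSTPPSubfamily 124 [(4,4,4),(4,4,4),(4,4,4),(4,4,4)]) ∧
      (∀ M, M = 126 ∨ M = 127 → NoSTPPSubfamily M [(4,4,4),(4,4,4),(4,4,4),(4,4,4)])) :
    NoAbelianSTPPHost_250_127 := by
  refine noAbelianSTPPHostUpTo_of_two (by norm_num) (by norm_num) ?_
  intro H _ _ hM N A B C h hne hN
  by_contra hlt
  rw [not_le] at hlt
  have hadm := h₀ H N A B C h hne
  have hbeats : Beats (5 / 2) (Fintype.card H) (fun i => (A i).card) (fun i => (B i).card)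
      (fun i => (C i).card) := by
    simpa only [Beats, shapeVol] using hlt
  rcases h₁ N (Fintype.card H) _ _ _ hN hM hadm hbeats with
    ⟨hM', hs⟩ | ⟨hM', hs | hs | hs⟩ | ⟨hM', hs | hs | hs | hs⟩ | ⟨hM', hs | hs⟩ | ⟨hM', hs⟩
  · exact h₃.1 H hM' N A B C h hs
  · exact (h₃.2 _ hM').1 H rfl N A B C h hs
  · exact (h₃.2 _ hM').2.1 H rfl N A B C h hs
  · exact (h₃.2 _ hM').2.2 H rfl N A B C h hs
  · exact h₄.1.1 H hM' N A B C h hs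
  · exact h₄.1.2.1 H hM' N A B C h hs
  · exact h₄.1.2.2.1 H hM' N A B C h hs
  · exact h₄.1.2.2.2 H hM' N A B C h hs
  · exact h₂.1 H hM' N A B C h hs
  · exact h₂.2 H hM' N A B C h hs
  · exact h₄.2 _ hM' H rfl N A B C h hs

end AbelianTECensus

end Summit.MatrixMultiplication.MatrixMultiplication.Theorems
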